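import Summits.Langlands.Langlands.Theorems.IrreducibilityBySelfDualityRegularTwistCM
import Summits.Langlands.Langlands.Theorems.IrreducibilityBySelfDualityRegularTwistCMPairingCore
import Summits.Langlands.Langlands.Theorems.IrreducibilityBySelfDualityRegularTwistCMComplexFactorCasimir
import Summits.Langlands.Langlands.Theorems.IrreducibilityBySelfDualityRegularTwistCMCompactPlaceIntegrality
import Summits.Langlands.Langlands.Theorems.IrreducibilityBySelfDualityRegularTwistCMInfinityTypeOfLocalPairing
import Summits.Langlands.Langlands.Theorems.IrreducibilityBySelfDualityRegularTwistCMLocalPairingTransfer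
import Literature.NumberTheory.Automorphic.AutomorphicRepInfinitesimalCharacter
import HarnessLib

/-!
# Crux `RegularTwistCM` (stmt-Langlands-14069) modulo EXACTLY its two printed inputs; the rank-2 infinity type
# (Theses-free, cycle-free)

Route `IrreducibilityBySelfDuality`, crux `RegularTwistCM` (rank 3): for `K` CM, `π` regular algebraic cuspidal on
`GL₃(𝔸_K)`, `σ₀` cuspidal on `GL₂(𝔸_K)` and a `GL(1)` datum `ν` with `t_π = d · Ad(t_{σ₀})` a.e., some `GL(1)`-twist
of `σ₀` is regular algebraic (Patrikis 2019, Prop. 1.3.1 on `(GL₂, SL₂)`).  The tree's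
`regularTwistCM_of_facts` (`…RegularTwistCM.lean`) proves the crux body modulo THREE archimedean named facts; the
third one — the existence of an infinity type for `GL₂` data, i.e. the integral pairing of the Harish-Chandra
parameters at a complex place (Clozel 1990, §3.3) — is PROVED here, so that the crux now rests on exactly its two
printed inputs:

* `exists_hasInfinityType_gl_two` — **every automorphic representation datum on `GL₂(𝔸_K)` (any number field)
  has an infinity type**: the named fact `AutomorphicRepData.exists_hasInfinityType` DISCHARGED at `n = 2`,
  UNCONDITIONALLY.  An archimedean parameter exists (`exists_hasArchParameter_gl`: Schur via `Z(𝔤)`-finiteness,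
  Borel–Jacquet 1979, 4.6); its integral pairing at each complex place is the `(𝔤, K)`-module argument of the
  line `petersson-hermitian-purity` (lead skeleton r4 of the crux): the complex-place dictionary
  `stub_complexFactorCasimir` (`ρ_w = L + R ∘ conj` with centre/Casimir scalars, Knapp 2002, Thm. 5.44),
  `𝔲(2)`-finiteness and torus integrality of `W / W'` (`stub_compactPlaceIntegrality`), and Naimark's
  bottom-`K`-type relation for `SL₂(ℂ)` (`stub_pairingCore`, via `Literature.Algebra.Lie.Sl2Pair.stepDown`:
  the step-down vector of a diagonal-primitive vector of minimal weight vanishes, forcing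
  `(m² - (a+b)²)(m² - (a-b)²) = 0`), glued by `stub_localPairingTransfer` and `stub_infinityTypeOfLocalPairing`.
* `regularTwistCM_of_GJ_smo` — **the crux body (verbatim, structural) modulo exactly its two printed inputs**
  (CONDITIONAL result; trust base = the named facts `GelbartJacquet_adjoint_lift_archimedean` — Gelbart–Jacquet
  1978, Thm. (9.3) with its archimedean clause — and `strong_multiplicity_one_gl_sphericalLevel 3 K` for all `K` —
  Jacquet–Shalika 1981 II, Thm. 4.4): `regularTwistCM_of_facts` with its third hypothesis discharged.

This module imports Theses-free modules only (no `Summits.….Theses.IrreducibilityBySelfDuality` in its closure): the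
day the two inputs are discharged, `regularTwistCM_of_GJ_smo h₁ h₂` closes the item by `δ`-unfolding without a cycle.
-/

set_option linter.dupNamespace false -- project-wide option (lakefile weak.linter.dupNamespace); `Summit.Langlands.Langlands` is the mandated namespace

noncomputable section

open scoped ComplexConjugate Classical
open NumberField Filter
open Literature.NumberTheory.Automorphic

namespace Summit.Langlands.Langlands.Theorems.RegularTwistCM

/-- **Every automorphic representation datum on `GL₂(𝔸_K)` has an infinity type** (the named fact
`AutomorphicRepData.exists_hasInfinityType` at `n = 2`, unconditionally; any number field `K`, any datum, no
cuspidality): an archimedean parameter exists (`exists_hasArchParameter_gl`) and pairs integrally at every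
complex place (`stub_localPairingTransfer` fed with `stub_pairingCore`, `stub_complexFactorCasimir`,
`stub_compactPlaceIntegrality`), whence a well-formed infinity type (`stub_infinityTypeOfLocalPairing`).
Clozel 1990, §3.3 ("type à l'infini": `z ↦ z^{p} z̄^{q}`, `p - q ∈ ℤ`); Knapp 1986, Ch. II §4 (the representations
of `SL₂(ℂ)`). [cite: Clozel1990, §3.3] -/
theorem exists_hasInfinityType_gl_two {K : Type} [Field K] [NumberField K]
    {hcpt : isCompact_glFiniteIntegralLevel 2 K} (π : AutomorphicRepData (AutomorphyDatum.gl 2 K hcpt)) :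
    π.exists_hasInfinityType := by
  obtain ⟨χ, hχ⟩ := π.exists_hasArchParameter_gl
  refine stub_infinityTypeOfLocalPairing π χ hχ fun w => ?_
  exact stub_localPairingTransfer
    (fun L R hLR s₁ s₂ t₁ t₂ hZL hCL hZR hCR hfin hint =>
      stub_pairingCore L R hLR s₁ s₂ t₁ t₂ hZL hCL hZR hCR hfin hint)
    (fun ρ χ' hχ' => stub_complexFactorCasimir ρ χ' hχ')
    (fun π' _ hρ' w' => stub_compactPlaceIntegrality π' hρ' w')
    π χ hχ w

/-- **The crux `RegularTwistCM` modulo exactly its two printed inputs** (CONDITIONAL on the named facts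
`GelbartJacquet_adjoint_lift_archimedean` and `strong_multiplicity_one_gl_sphericalLevel 3 K`; structural
statement = the body of `Summit.Langlands.Langlands.Theses.IrreducibilityBySelfDuality.RegularTwistCM` verbatim):
`regularTwistCM_of_facts` with the rank-2 infinity type `exists_hasInfinityType_gl_two` supplied.  For `K` CM,
`π` regular algebraic cuspidal on `GL₃(𝔸_K)`, `σ₀` cuspidal on `GL₂(𝔸_K)`, `ν` a `GL(1)` datum with
`t_π = d · Ad(t_{σ₀})` a.e., some `GL(1)`-twist of `σ₀` is regular algebraic. [cite: Patrikis2019, Prop. 1.3.1]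
[cite: GelbartJacquet1978, Thm. (9.3)] [cite: JacquetShalikaAJM1981II, Thm. 4.4] -/
theorem regularTwistCM_of_GJ_smo
    (hGJ : Literature.NumberTheory.Automorphic.GelbartJacquet_adjoint_lift_archimedean)
    (hsmo : ∀ (K : Type) [Field K] [NumberField K],
      Literature.NumberTheory.Automorphic.strong_multiplicity_one_gl_sphericalLevel 3 K) :
    ∀ (K : Type) [Field K] [NumberField K], NumberField.IsCMField K →
      ∀ (h1 : Literature.NumberTheory.Automorphic.isCompact_glFiniteIntegralLevel 1 K)
        (hcpt₂ : Literature.NumberTheory.Automorphic.isCompact_glFiniteIntegralLevel 2 K)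
        (hcpt : Literature.NumberTheory.Automorphic.isCompact_glFiniteIntegralLevel 3 K)
        (π : Literature.NumberTheory.Automorphic.CuspidalAutomorphicRepData 3 K hcpt)
        (σ₀ : Literature.NumberTheory.Automorphic.CuspidalAutomorphicRepData 2 K hcpt₂)
        (ν : Literature.NumberTheory.Automorphic.CuspidalAutomorphicRepData 1 K h1),
        π.1.IsRegularAlgebraic →
        (∀ᶠ v in cofinite, ∀ α β : Multiset ℂ, π.1.HasSatakeParamAt v α →
          σ₀.1.HasSatakeParamAt v β → ∃ d : ℂ, ν.1.HasSatakeParamAt v {d} ∧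
            α = (((β ×ˢ β).map (fun p : ℂ × ℂ => p.1 * p.2⁻¹)).erase 1).map (fun c => d * c)) →
        ∃ (σ : Literature.NumberTheory.Automorphic.CuspidalAutomorphicRepData 2 K hcpt₂)
          (χ : Literature.NumberTheory.Automorphic.CuspidalAutomorphicRepData 1 K h1),
          σ.1.IsRegularAlgebraic ∧ ∀ᶠ v in cofinite, ∀ β : Multiset ℂ, σ₀.1.HasSatakeParamAt v β →
            ∃ c : ℂ, χ.1.HasSatakeParamAt v {c} ∧ σ.1.HasSatakeParamAt v (β.map (fun b => c * b)) :=
  regularTwistCM_of_facts hGJ hsmo (fun _K _ _ _hcpt₂ σ₀ => exists_hasInfinityType_gl_two σ₀.1)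

end Summit.Langlands.Langlands.Theorems.RegularTwistCM

end
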